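import Literature.NumberTheory.Automorphic.GaloisActionPlaces
import Mathlib.NumberTheory.RamificationInertia.Galois
import Mathlib.FieldTheory.Finite.GaloisField
import Mathlib.NumberTheory.NumberField.Ideal.Basic
import Mathlib.RingTheory.DedekindDomain.Ideal.Lemmas
import Mathlib.RingTheory.Trace.Basic
import Mathlib.RingTheory.IntegralClosure.IntegralRestrict
import HarnessLib

/-!
# Traces modulo an unramified prime of a Galois extension are surjective

Topic `NumberTheory/GaloisRepresentations` (class field theory: the residue-field trace step of
Childress, *Class Field Theory*, Ch. 4 §5 Lemma 5.3 (a), PDF p. 95 — the higher layers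
`(1 + 𝔭ⁱ)/(1 + 𝔭ⁱ⁺¹)` of the unit filtration are covered by norms because the residue trace is
surjective); namespace `Literature.NumberTheory.GaloisRepresentations.ResidueTrace`.
Everything **proved** (companion of `UnramifiedResidueNorm.lean`, sums instead of products).

* `ResidueTrace.exists_intTrace_sub_mem` (for Mathlib's `Algebra.intTrace (𝓞 F) (𝓞 E)`) — for a finite Galois extension of number fields `E/F`, a
  finite place `v` of `F` unramified in `E` and `c ∈ 𝓞 F`, there is `β ∈ 𝓞 E` with
  `Tr_{E/F}(β) ≡ c (mod 𝔭_v)` (as `v(Tr β - c) < 1`).  Proof: the decomposition group of `𝔓 ∣ 𝔭_v`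
  maps isomorphically onto `Gal(k_𝔓/k_v)`, the trace of finite fields is surjective (Mathlib
  `Algebra.trace_surjective`), and `β ≡ β₀ (mod 𝔓)`, `β ≡ 0` modulo the other primes above `𝔭_v`
  has `Tr_{E/F}(β) = ∑_σ σβ ≡ Tr_{k_𝔓/k_v}(β̄₀) (mod 𝔓)`.

## References

* N. Childress, *Class Field Theory*, Universitext, Springer 2009, Ch. 4 §5 Lemma 5.3 (PDF p. 95).
  [Childress2009]
* J. W. S. Cassels, A. Fröhlich (eds.), *Algebraic Number Theory* (1967), Ch. I §7 (unramified
  extensions: trace on integers surjective). [CasselsFrohlichANT1967]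
-/

noncomputable section

open NumberField IsDedekindDomain

namespace Literature.NumberTheory.GaloisRepresentations

namespace ResidueTrace

open Literature.NumberTheory.Automorphic

attribute [local instance] Ideal.Quotient.field

open scoped Pointwise

variable {F : Type*} [Field F] [NumberField F] {E : Type*} [Field E] [NumberField E] [Algebra F E]

/-- `Tr_{E/F}(β) = ∑_σ σ β` inside `𝓞 E` for `E/F` Galois, for Mathlib's integral trace
`Algebra.intTrace (𝓞 F) (𝓞 E)` (`Algebra.algebraMap_intTrace`). [folklore] -/
theorem algebraMap_intTrace_eq_sum [IsGalois F E] (β : 𝓞 E) :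
    algebraMap (𝓞 F) (𝓞 E) (Algebra.intTrace (𝓞 F) (𝓞 E) β) = ∑ σ : E ≃ₐ[F] E, σ • β := by
  haveI : FiniteDimensional F E := Module.Finite.of_restrictScalars_finite ℚ F E
  apply RingOfIntegers.ext
  rw [show ((algebraMap (𝓞 F) (𝓞 E) (Algebra.intTrace (𝓞 F) (𝓞 E) β) : 𝓞 E) : E) =
      algebraMap F E (algebraMap (𝓞 F) F (Algebra.intTrace (𝓞 F) (𝓞 E) β)) from rfl,
    Algebra.algebraMap_intTrace (A := 𝓞 F) (B := 𝓞 E) (K := F) (L := E), trace_eq_sum_automorphisms]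
  push_cast
  rfl

/-- **Childress Lemma 5.3 (a), residue-trace step (global form).**  Let `E/F` be a finite Galois
extension of number fields, `v` a finite place of `F` unramified in `E`, and `c ∈ 𝓞 F`.  Then
there is `β ∈ 𝓞 E` with `Tr_{E/F}(β) - c ∈ 𝔭_v`.
[cite: Childress2009, Ch. 4 §5 Lemma 5.3 (PDF p. 95)] -/
theorem exists_intTrace_sub_mem [IsGalois F E] (v : HeightOneSpectrum (𝓞 F))
    (hunr : v.asIdeal.ramificationIdxIn (𝓞 E) = 1) (c : 𝓞 F) :
    ∃ β : 𝓞 E, Algebra.intTrace (𝓞 F) (𝓞 E) β - c ∈ v.asIdeal := by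
  classical
  -- a prime above `v`
  obtain ⟨Q₀, hQ₀m, hQ₀⟩ := Ideal.exists_maximal_ideal_liesOver_of_isIntegral (S := 𝓞 E) v.asIdeal
  haveI : Q₀.IsMaximal := hQ₀m
  haveI : Q₀.LiesOver v.asIdeal := hQ₀
  have hQ₀ne : Q₀ ≠ ⊥ := Ideal.ne_bot_of_liesOver_of_ne_bot v.ne_bot Q₀
  set w₀ : HeightOneSpectrum (𝓞 E) := ⟨Q₀, hQ₀m.isPrime, hQ₀ne⟩ with hw₀def
  have hw₀v : w₀.under (𝓞 F) = v := HeightOneSpectrum.ext (Ideal.LiesOver.over (P := Q₀) (p := v.asIdeal)).symm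
  haveI : v.asIdeal.IsMaximal := v.isMaximal
  -- residue fields
  set k := 𝓞 F ⧸ v.asIdeal
  set k' := 𝓞 E ⧸ Q₀
  set G := E ≃ₐ[F] E
  -- a preimage under the trace of finite fields
  obtain ⟨x, hx⟩ := Algebra.trace_surjective k k' (Ideal.Quotient.mk v.asIdeal c)
  obtain ⟨β₀, hβ₀⟩ := Ideal.Quotient.mk_surjective x
  -- CRT: `β ≡ β₀ (Q₀)`, `β ≡ 0` at the other places above `v`
  set T : Finset (HeightOneSpectrum (𝓞 E)) :=
    (IsDedekindDomain.primesOver_finite v.asIdeal (𝓞 E)).toFinset.preimage HeightOneSpectrum.asIdeal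
      (fun w _ w' _ h => HeightOneSpectrum.ext h) with hTdef
  have hmemT : ∀ w : HeightOneSpectrum (𝓞 E), w ∈ T ↔ w.under (𝓞 F) = v := by
    intro w
    rw [hTdef, Finset.mem_preimage, Set.Finite.mem_toFinset]
    constructor
    · rintro ⟨_, hover⟩
      exact HeightOneSpectrum.ext hover.over.symm
    · intro h
      exact ⟨w.isPrime, ⟨by rw [← h]; rfl⟩⟩
  obtain ⟨β, hβ⟩ := IsDedekindDomain.exists_forall_sub_mem_ideal (s := T) (fun w => w.asIdeal) (fun _ => 1)
    (fun w _ => w.prime) (fun w _ w' _ hne h => hne (HeightOneSpectrum.ext h))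
    (fun w => if (w : HeightOneSpectrum (𝓞 E)) = w₀ then β₀ else 0)
  have hw₀T : w₀ ∈ T := (hmemT w₀).mpr hw₀v
  have hβ₀' : β - β₀ ∈ Q₀ := by
    have := hβ w₀ hw₀T
    simp only [↓reduceIte, pow_one] at this
    exact this
  have hβ1 : ∀ w ∈ T, w ≠ w₀ → β ∈ w.asIdeal := fun w hw hne => by
    have := hβ w hw
    simp only [hne, ↓reduceIte, pow_one, sub_zero] at this
    exact this
  refine ⟨β, ?_⟩
  -- decomposition group ≅ residue Galois group (unramified)
  have hinj : Function.Injective (Ideal.Quotient.stabilizerHom Q₀ v.asIdeal G) := by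
    have h1 : (Ideal.Quotient.stabilizerHom Q₀ v.asIdeal G).ker.map (Subgroup.subtype _) = ⊥ := by
      rw [Ideal.Quotient.map_ker_stabilizer_subtype]
      apply Subgroup.eq_bot_of_card_eq
      rw [Ideal.card_inertia_eq_ramificationIdxIn (G := G) v.asIdeal Q₀, hunr]
    exact (MonoidHom.ker_eq_bot_iff _).mp
      ((Subgroup.map_eq_bot_iff_of_injective _ (Subgroup.subtype_injective _)).mp h1)
  have hbij : Function.Bijective (Ideal.Quotient.stabilizerHom Q₀ v.asIdeal G) :=
    ⟨hinj, Ideal.Quotient.stabilizerHom_surjective G v.asIdeal Q₀⟩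
  -- `σ β mod Q₀`
  have hmod : ∀ σ : G, Ideal.Quotient.mk Q₀ (σ • β) =
      if hσ : σ ∈ MulAction.stabilizer G Q₀ then
        Ideal.Quotient.stabilizerHom Q₀ v.asIdeal G ⟨σ, hσ⟩ (Ideal.Quotient.mk Q₀ β₀) else 0 := by
    intro σ
    split_ifs with hσ
    · rw [Ideal.Quotient.stabilizerHom_apply, Subgroup.mk_smul, Ideal.Quotient.eq]
      rw [← smul_sub]
      have : σ • (β - β₀) ∈ σ • Q₀ := Ideal.smul_mem_pointwise_smul_iff.mpr hβ₀'
      rwa [show σ • Q₀ = Q₀ from hσ] at this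
    · have hw' : (σ⁻¹ • w₀).under (𝓞 F) = v := by rw [HeightOneSpectrum.under_algEquiv_smul, hw₀v]
      have hne : σ⁻¹ • w₀ ≠ w₀ := fun h => hσ (by
        have := congrArg HeightOneSpectrum.asIdeal h
        rw [HeightOneSpectrum.smul_asIdeal] at this
        rw [MulAction.mem_stabilizer_iff]
        have h2 := congrArg (fun I => σ • I) this
        simp only [smul_inv_smul] at h2
        exact h2.symm)
      have h1 := hβ1 _ ((hmemT _).mpr hw') hne
      rw [HeightOneSpectrum.smul_asIdeal] at h1
      have : σ • β ∈ σ • (σ⁻¹ • Q₀) := Ideal.smul_mem_pointwise_smul_iff.mpr h1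
      rw [smul_inv_smul] at this
      exact Ideal.Quotient.eq_zero_iff_mem.mpr this
  -- the sum over `G`
  have hsum : Ideal.Quotient.mk Q₀ (∑ σ : G, σ • β) =
      algebraMap k k' (Algebra.trace k k' (Ideal.Quotient.mk Q₀ β₀)) := by
    rw [map_sum, trace_eq_sum_automorphisms,
      ← (Equiv.ofBijective _ hbij).sum_comp (fun τ => τ (Ideal.Quotient.mk Q₀ β₀))]
    simp only [Equiv.ofBijective_apply]
    rw [← Finset.sum_subset (Finset.subset_univ (Finset.univ.filter (· ∈ MulAction.stabilizer G Q₀)))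
      (fun σ _ hσ => by
        rw [Finset.mem_filter, not_and] at hσ
        rw [hmod σ, dif_neg (hσ (Finset.mem_univ σ))])]
    rw [Finset.sum_subtype (Finset.univ.filter (· ∈ MulAction.stabilizer G Q₀))
      (p := (· ∈ MulAction.stabilizer G Q₀)) (fun σ => by simp)]
    refine Finset.sum_congr rfl fun σ _ => ?_
    rw [hmod σ, dif_pos σ.2]
  -- conclude modulo `Q₀ ∩ 𝓞 F = 𝔭_v`
  have htrQ : algebraMap (𝓞 F) (𝓞 E) (Algebra.intTrace (𝓞 F) (𝓞 E) β - c) ∈ Q₀ := by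
    rw [map_sub, algebraMap_intTrace_eq_sum, ← Ideal.Quotient.eq, hsum, hβ₀, hx]
    rfl
  have : Algebra.intTrace (𝓞 F) (𝓞 E) β - c ∈ Q₀.comap (algebraMap (𝓞 F) (𝓞 E)) := htrQ
  rwa [← Ideal.under_def, ← Ideal.LiesOver.over (P := Q₀) (p := v.asIdeal)] at this

end ResidueTrace

end Literature.NumberTheory.GaloisRepresentations
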